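import Summits.PneNP.PneNP.Theses.BavardGap
import Summits.PneNP.PneNP.Theorems.BavardGapPgBridge
import Literature.Computability.Complexity.RandomizedProofs
import Literature.Computability.Complexity.TimeBoundsProofs
import Literature.Computability.Complexity.CodeFPArith
import Literature.Computability.Complexity.CodeFPStrings
import Literature.Computability.Complexity.CodeFPLists

/-!
# Route BavardGap — `PlantedGlueR` (stmt-PneNP-10859)

`FirstOrderGap → PlantedGenusPseudorandomR → BavardGapUncertifiable` (with `C = 0`). If a sound polynomial-time genus
refuter `R` were `0`-tight on at least half of the reduced balanced words of length `2n` for all large `n`, the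
DETERMINISTIC distinguisher `D(1ⁿ, s) := R (letters of s, θ(2n) + θ(2n)/q₀)` (`θ(m) = m / (6 ⌊log₃ m⌋)`, `q₀` from
`FirstOrderGap`) is PPT (`RandAlg.ofDet`, `IsPolyTime.ofDet_holds`, one typed `CodeFP` parser composed with the machine
of `R` by `PolyTimeComputable.comp_holds`), accepts the planted words with probability `0` for all large `n` (soundness:
they carry a pairing of genus `≤ θ + θ/q₀`), and accepts the uniform reduced balanced word with probability
`≥ 1/2 - o(1)` (`0`-tightness minus the vanishing fraction of words of pairing genus `≤ θ + θ/q₀`); advantage `≥ 1/4`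
eventually, contradicting `PlantedGenusPseudorandomR`.
-/

set_option linter.dupNamespace false -- `Summit.PneNP.PneNP.…`: summit = sub-problem name (D-0017 single-conjunct layout)

namespace Summit.PneNP.PneNP.Theorems

open _root_.Computability Polynomial Filter
open Literature.Computability.Complexity Literature.Computability.Complexity.CodeFP
  Literature.Computability.Complexity.Brick

/-! ### `⌊log₃ m⌋` on codes -/

/-- Counting the exponents `k < j` with `3^{k+1} ≤ m` gives `min j ⌊log₃ m⌋`. [folklore] -/
theorem bavardGap_sum_indicator_range (m : ℕ) : ∀ j : ℕ,
    ((List.range j).map fun k => if 3 ^ (k + 1) ≤ m then 1 else 0).sum = min j (Nat.log 3 m)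
  | 0 => by simp
  | j + 1 => by
    rw [List.range_succ, List.map_append, List.sum_append, bavardGap_sum_indicator_range m j, List.map_singleton,
      List.sum_singleton]
    by_cases h : 3 ^ (j + 1) ≤ m
    · rw [if_pos h]
      have hj : j + 1 ≤ Nat.log 3 m := Nat.le_log_of_pow_le (by norm_num) h
      rw [min_eq_left (by omega), min_eq_left hj]
    · rw [if_neg h, add_zero]
      rcases Nat.eq_zero_or_pos m with hm | hm
      · simp [hm]
      · have hj : ¬ j + 1 ≤ Nat.log 3 m := fun hj => h (Nat.pow_le_of_le_log hm.ne' hj)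
        rw [min_eq_right (by omega), min_eq_right (by omega)]

/-- `⌊log₃ m⌋` as a count over `[0, m)` (with the exponent capped at `m`, as the program computes it). [folklore] -/
theorem bavardGap_sum_indicator_eq_log (m : ℕ) :
    ((List.range m).map fun k => if 3 ^ min (k + 1) m ≤ m then 1 else 0).sum = Nat.log 3 m := by
  have h : ((List.range m).map fun k => if 3 ^ min (k + 1) m ≤ m then 1 else 0) =
      (List.range m).map fun k => if 3 ^ (k + 1) ≤ m then 1 else 0 := by
    refine List.map_congr_left fun k hk => ?_
    rw [List.mem_range] at hk
    rw [min_eq_left (by omega)]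
  rw [h, bavardGap_sum_indicator_range, min_eq_right (Nat.log_le_self 3 m)]

/-- **`1ᵐ ↦ ⌊log₃ m⌋` (binary) is computed on codes** (count the `k < m` with `3^{k+1} ≤ m`). [cite: AroraBarak2009, §1.3] -/
theorem bavardGap_codeFP_log3 : CodeFP unE natE fun m : ℕ => Nat.log 3 m := by
  have hctx : CodeFP unE (pairE (pairE unE natE) (rawE natE)) fun m : ℕ => ((m, m), List.range m) :=
    ((CodeFP.id unE).pair natOfUn).pair urange
  have hmu : CodeFP (pairE (pairE unE natE) natE) unE fun t : (ℕ × ℕ) × ℕ => t.1.1 := (CodeFP.fst _ _).fst'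
  have hmn : CodeFP (pairE (pairE unE natE) natE) natE fun t : (ℕ × ℕ) × ℕ => t.1.2 := (CodeFP.fst _ _).snd'
  have hk1 : CodeFP (pairE (pairE unE natE) natE) natE fun t : (ℕ × ℕ) × ℕ => t.2 + 1 :=
    (natAdd.comp ((CodeFP.snd _ _).pair (CodeFP.const _ 1)) :)
  have hexp : CodeFP (pairE (pairE unE natE) natE) unE fun t : (ℕ × ℕ) × ℕ => min (t.2 + 1) t.1.1 :=
    (unOfNatMin.comp (hmu.pair hk1) :)
  have hpow : CodeFP (pairE (pairE unE natE) natE) natE fun t : (ℕ × ℕ) × ℕ => 3 ^ min (t.2 + 1) t.1.1 :=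
    (natPow.comp ((CodeFP.const _ 3).pair hexp) :)
  have hle : CodeFP (pairE (pairE unE natE) natE) bitE fun t : (ℕ × ℕ) × ℕ => decide (3 ^ min (t.2 + 1) t.1.1 ≤ t.1.2) :=
    (natLe.comp (hpow.pair hmn) :)
  have hg : CodeFP (pairE (pairE unE natE) natE) natE
      fun t : (ℕ × ℕ) × ℕ => if decide (3 ^ min (t.2 + 1) t.1.1 ≤ t.1.2) then 1 else 0 :=
    hle.ite (CodeFP.const _ 1) (CodeFP.const _ 0)
  have hmap := ((CodeFP.map hg).comp hctx :)
  refine ((natSum.comp hmap :)).congr fun m => ?_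
  dsimp only [Function.comp_def]
  rw [← bavardGap_sum_indicator_eq_log m]
  congr 1
  refine List.map_congr_left fun k _ => ?_
  simp only [decide_eq_true_eq]

/-- **The threshold `θ(2n) + θ(2n)/q` on codes**, `θ(m) = m / (6 ⌊log₃ m⌋)`, unary in, unary out (it is `≤ 2n`).
[cite: AroraBarak2009, §1.3] -/
theorem bavardGap_codeFP_threshold (q : ℕ) : CodeFP unE unE fun n : ℕ =>
    2 * n / (6 * Nat.log 3 (2 * n)) + 2 * n / (6 * Nat.log 3 (2 * n)) / q := by
  have h2 : CodeFP unE unE fun n : ℕ => 2 * n := (unAdd.comp ((CodeFP.id unE).pair (CodeFP.id unE))).congr fun n => by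
    show n + n = 2 * n; ring
  have hlog : CodeFP unE natE fun n : ℕ => 6 * Nat.log 3 (2 * n) :=
    (natMul.comp ((CodeFP.const _ 6).pair (bavardGap_codeFP_log3.comp h2)) :)
  have hθ : CodeFP unE natE fun n : ℕ => 2 * n / (6 * Nat.log 3 (2 * n)) := (natDiv.comp ((natOfUn.comp h2).pair hlog) :)
  have hT : CodeFP unE natE fun n : ℕ => 2 * n / (6 * Nat.log 3 (2 * n)) + 2 * n / (6 * Nat.log 3 (2 * n)) / q :=
    (natAdd.comp (hθ.pair (natDiv.comp (hθ.pair (CodeFP.const _ q)))) :)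
  refine ((unOfNatMin.comp (h2.pair hT) :)).congr fun n => ?_
  show min (2 * n / (6 * Nat.log 3 (2 * n)) + 2 * n / (6 * Nat.log 3 (2 * n)) / q) (2 * n) = _
  apply min_eq_left
  have h1 : 2 * n / (6 * Nat.log 3 (2 * n)) ≤ 2 * n / 2 := by
    rcases Nat.eq_zero_or_pos (Nat.log 3 (2 * n)) with h0 | h0
    · rw [h0, mul_zero, Nat.div_zero]; exact Nat.zero_le _
    · exact Nat.div_le_div_left (by omega) (by norm_num)
  have h3 : 2 * n / (6 * Nat.log 3 (2 * n)) / q ≤ 2 * n / (6 * Nat.log 3 (2 * n)) := Nat.div_le_self _ _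
  omega

/-! ### The 2-bit letter code and its decoder -/

/-- Reading the letter code in 2-bit blocks reproduces its even-length prefix. [folklore] -/
theorem bavardGap_flatMap_range_getD (s : List Bool) : ∀ k : ℕ, 2 * k ≤ s.length →
    ((List.range k).flatMap fun i => [s.getD (2 * i) false, s.getD (2 * i + 1) false]) = s.take (2 * k)
  | 0, _ => by simp
  | k + 1, hk => by
    rw [List.range_succ, List.flatMap_append, bavardGap_flatMap_range_getD s k (by omega), List.flatMap_singleton,
      show 2 * (k + 1) = 2 * k + 1 + 1 by ring, List.take_add_one, List.take_add_one, List.append_assoc]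
    congr 1
    have h1 : 2 * k < s.length := by omega
    have h2 : 2 * k + 1 < s.length := by omega
    rw [List.getElem?_eq_getElem h1, List.getElem?_eq_getElem h2, List.getD_eq_getElem _ _ h1,
      List.getD_eq_getElem _ _ h2]
    rfl

/-- `code (dec s)` is the even-length prefix of `s`. [folklore] -/
theorem bavardGap_code_dec (s : List Bool) :
    (((List.range (s.length / 2)).map fun i =>
        ((if s.getD (2 * i) false then (1 : Fin 2) else 0), s.getD (2 * i + 1) false)).flatMap
        fun a => [decide (a.1 = 1), a.2]) = s.take (2 * (s.length / 2)) := by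
  rw [List.flatMap_map, ← bavardGap_flatMap_range_getD s (s.length / 2) (Nat.mul_div_le _ _)]
  refine List.flatMap_congr fun i _ => ?_
  dsimp only [Function.comp_apply]
  cases s.getD (2 * i) false <;> rfl

/-- `dec (code l) = l`. [folklore] -/
theorem bavardGap_dec_code : ∀ l : List (Fin 2 × Bool),
    ((List.range ((l.flatMap fun a => [decide (a.1 = 1), a.2]).length / 2)).map fun i =>
        ((if (l.flatMap fun a => [decide (a.1 = 1), a.2]).getD (2 * i) false then (1 : Fin 2) else 0),
          (l.flatMap fun a => [decide (a.1 = 1), a.2]).getD (2 * i + 1) false)) = l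
  | [] => rfl
  | a :: l => by
    have ih := bavardGap_dec_code l
    rw [bavardGap_length_flatMap] at ih ⊢
    rw [List.length_cons, show 2 * (l.length + 1) / 2 = l.length + 1 by omega, List.range_succ_eq_map, List.map_cons,
      List.map_map]
    rw [show 2 * l.length / 2 = l.length by omega] at ih
    congr 1
    simp only [List.flatMap_cons, mul_zero, zero_add]
    refine Prod.ext ?_ ?_
    · have ha := a.1.isLt
      by_cases h1 : a.1 = 1
      · simp [h1]
      · have h0 : a.1 = 0 := Fin.ext (by have : a.1.val ≠ 1 := fun h => h1 (Fin.ext h); omega)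
        simp [h0]
    · simp
    -- (the tail goal `map (reader ∘ succ) (range |l|) = l` is `ih` up to `2 * (i + 1) ≡ 2 * i + 2`, closed by `congr`)

/-! ### The distinguisher is polynomial time -/

/-- **The typed parser** `z = ⟨u, s⟩ ↦ (even prefix of s, θ(2|u|) + θ(2|u|)/q)`. [cite: AroraBarak2009, §1.3] -/
theorem bavardGap_codeFP_parse (q : ℕ) : CodeFP strE (pairE strE unE) fun z : List Bool =>
    ((sndF z).take (2 * ((sndF z).length / 2)),
      2 * (fstF z).length / (6 * Nat.log 3 (2 * (fstF z).length)) +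
        2 * (fstF z).length / (6 * Nat.log 3 (2 * (fstF z).length)) / q) := by
  have hfst : CodeFP strE strE fun w : List Bool => fstF w := CodeFP.of_fn fstF fstF_mem_FP fun _ => rfl
  have hsnd : CodeFP strE strE fun w : List Bool => sndF w := CodeFP.of_fn sndF sndF_mem_FP fun _ => rfl
  have hlen : CodeFP strE unE fun s : List Bool => s.length := strLength
  have hhalf : CodeFP strE natE fun s : List Bool => 2 * (s.length / 2) :=
    (natMul.comp ((CodeFP.const _ 2).pair (natDiv.comp ((natOfUn.comp hlen).pair (CodeFP.const _ 2)))) :)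
  have heven : CodeFP strE unE fun s : List Bool => 2 * (s.length / 2) :=
    ((unOfNatMin.comp (hlen.pair hhalf) :)).congr fun s => by
      show min (2 * (s.length / 2)) s.length = _
      exact min_eq_left (by omega)
  have hrec : CodeFP strE strE fun s : List Bool => s.take (2 * (s.length / 2)) :=
    (strTake.comp (heven.pair (CodeFP.id strE)) :)
  have hn : CodeFP strE unE fun z : List Bool => (fstF z).length := (hlen.comp hfst :)
  exact ((hrec.comp hsnd).pair ((bavardGap_codeFP_threshold q).comp hn) :)

/-- **The deterministic distinguisher `z = ⟨1ⁿ, s⟩ ↦ R (dec s, θ(2n) + θ(2n)/q)` is polynomial time** (the parser, then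
the machine of `R`, `PolyTimeComputable.comp_holds`). [cite: AroraBarak2009, §1.3] -/
theorem bavardGap_polyTime_distinguisher (q : ℕ) {R : List (Fin 2 × Bool) × ℕ → Bool}
    (hR : PolyTimeComputable (fun p : List (Fin 2 × Bool) × ℕ =>
      boolPair ((p.1).flatMap fun a => [decide (a.1 = 1), a.2]) (unaryEncodeNat p.2)) encodeBool R) :
    PolyTimeComputable (id : List Bool → List Bool) encodeBool fun z : List Bool =>
      R ((List.range ((sndF z).length / 2)).map fun i =>
          ((if (sndF z).getD (2 * i) false then (1 : Fin 2) else 0), (sndF z).getD (2 * i + 1) false),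
        2 * (fstF z).length / (6 * Nat.log 3 (2 * (fstF z).length)) +
          2 * (fstF z).length / (6 * Nat.log 3 (2 * (fstF z).length)) / q) := by
  obtain ⟨F, ⟨p, M, hM⟩, hFspec⟩ := bavardGap_codeFP_parse q
  have hparse : PolyTimeComputable (id : List Bool → List Bool)
      (fun p : List (Fin 2 × Bool) × ℕ => boolPair ((p.1).flatMap fun a => [decide (a.1 = 1), a.2]) (unaryEncodeNat p.2))
      (fun z : List Bool => (((List.range ((sndF z).length / 2)).map fun i =>
          ((if (sndF z).getD (2 * i) false then (1 : Fin 2) else 0), (sndF z).getD (2 * i + 1) false)),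
        2 * (fstF z).length / (6 * Nat.log 3 (2 * (fstF z).length)) +
          2 * (fstF z).length / (6 * Nat.log 3 (2 * (fstF z).length)) / q)) := by
    refine ⟨p, M, fun z => ?_⟩
    have h := hM z
    have hF : F z = boolPair ((((List.range ((sndF z).length / 2)).map fun i =>
          ((if (sndF z).getD (2 * i) false then (1 : Fin 2) else 0), (sndF z).getD (2 * i + 1) false))).flatMap
          fun a => [decide (a.1 = 1), a.2])
        (unaryEncodeNat (2 * (fstF z).length / (6 * Nat.log 3 (2 * (fstF z).length)) +
          2 * (fstF z).length / (6 * Nat.log 3 (2 * (fstF z).length)) / q)) := by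
      rw [bavardGap_code_dec, show F z = F (strE z) from rfl, hFspec z, pairE_apply]
      rfl
    rw [show (id (F z) : List Bool) = F z from rfl, hF] at h
    exact h
  exact PolyTimeComputable.comp_holds hR hparse

/-- The distinguisher on a genuine instance `⟨1ⁿ, code l⟩` runs `R (l, θ(2n) + θ(2n)/q)`. [folklore] -/
theorem bavardGap_distinguisher_apply (q : ℕ) (R : List (Fin 2 × Bool) × ℕ → Bool) (n : ℕ) (l : List (Fin 2 × Bool)) :
    R ((List.range ((sndF (boolPair (unaryEncodeNat n) (l.flatMap fun a => [decide (a.1 = 1), a.2]))).length / 2)).map fun i =>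
          ((if (sndF (boolPair (unaryEncodeNat n) (l.flatMap fun a => [decide (a.1 = 1), a.2]))).getD (2 * i) false
              then (1 : Fin 2) else 0),
            (sndF (boolPair (unaryEncodeNat n) (l.flatMap fun a => [decide (a.1 = 1), a.2]))).getD (2 * i + 1) false),
        2 * (fstF (boolPair (unaryEncodeNat n) (l.flatMap fun a => [decide (a.1 = 1), a.2]))).length /
            (6 * Nat.log 3 (2 * (fstF (boolPair (unaryEncodeNat n) (l.flatMap fun a => [decide (a.1 = 1), a.2]))).length)) +
          2 * (fstF (boolPair (unaryEncodeNat n) (l.flatMap fun a => [decide (a.1 = 1), a.2]))).length /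
            (6 * Nat.log 3 (2 * (fstF (boolPair (unaryEncodeNat n) (l.flatMap fun a => [decide (a.1 = 1), a.2]))).length)) / q) =
      R (l, 2 * n / (6 * Nat.log 3 (2 * n)) + 2 * n / (6 * Nat.log 3 (2 * n)) / q) := by
  rw [sndF_boolPair, fstF_boolPair, bavardGap_dec_code, show (unaryEncodeNat n).length = n from length_unE n]

/-! ### Acceptance probabilities of a deterministic distinguisher -/

/-- A deterministic test never firing on the support is accepted with probability `0`. [folklore] -/
theorem bavardGap_bind_ofDet_apply_true_eq_zero (P : PMF (List Bool)) (G : List Bool → Bool) (n : ℕ)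
    (h : ∀ s ∈ P.support, G (boolPair (unaryEncodeNat n) s) = false) :
    ((P.bind fun s => (RandAlg.ofDet G).outputPMF id (boolPair (unaryEncodeNat n) s)) true).toReal = 0 := by
  simp only [RandAlg.outputPMF_ofDet]
  rw [show (P.bind fun s => PMF.pure (G (boolPair (unaryEncodeNat n) s))) =
      P.map (fun s => G (boolPair (unaryEncodeNat n) s)) from rfl, ← PMF.toOuterMeasure_apply_singleton,
    PMF.toOuterMeasure_map_apply, ENNReal.toReal_eq_zero_iff]
  left
  rw [PMF.toOuterMeasure_apply_eq_zero_iff, Set.disjoint_left]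
  intro s hs hG
  have h' := h s hs
  simp only [Set.mem_preimage, Set.mem_singleton_iff] at hG
  rw [h'] at hG
  exact Bool.false_ne_true hG

/-- Acceptance probability of a deterministic test on (a code of) the uniform element of a non-empty finset: the
accepted fraction. [folklore] -/
theorem bavardGap_null_accept {α : Type} (W : Finset α) (hW : W.Nonempty) (code : α → List Bool) (G : List Bool → Bool)
    (n : ℕ) [DecidablePred fun w : α => G (boolPair (unaryEncodeNat n) (code w)) = true] :
    (((if h : W.Nonempty then (PMF.uniformOfFinset W h).map code else PMF.pure []).bind
        fun s => (RandAlg.ofDet G).outputPMF id (boolPair (unaryEncodeNat n) s)) true).toReal =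
      ((W.filter fun w => G (boolPair (unaryEncodeNat n) (code w)) = true).card : ℝ) / W.card := by
  classical
  rw [dif_pos hW]
  simp only [RandAlg.outputPMF_ofDet]
  rw [show (((PMF.uniformOfFinset W hW).map code).bind fun s => PMF.pure (G (boolPair (unaryEncodeNat n) s))) =
      ((PMF.uniformOfFinset W hW).map code).map (fun s => G (boolPair (unaryEncodeNat n) s)) from rfl, PMF.map_comp,
    ← PMF.toOuterMeasure_apply_singleton, PMF.toOuterMeasure_map_apply, PMF.toOuterMeasure_uniformOfFinset_apply,
    ENNReal.toReal_div, ENNReal.toReal_natCast, ENNReal.toReal_natCast]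
  congr 3
  exact Finset.filter_congr (fun w _ => Iff.rfl)

/-- **The counting step**: `0`-tight on `≥ 1/2`, genus-small on `< 1/8`, and tight-not-small words accepted give an
accepted fraction `≥ 1/4` of a non-empty set. [folklore] -/
theorem bavardGap_count_bound {α : Type} (W : Finset α) (tight small good : α → Prop)
    {it : DecidablePred tight} {is : DecidablePred small} [DecidablePred good]
    (h1 : ¬ ((W.filter tight).card : ℝ) / (W.card : ℝ) < 1 / 2)
    (h2 : ((W.filter small).card : ℝ) / (W.card : ℝ) < 1 / 8)
    (h3 : ∀ w ∈ W, tight w → ¬ small w → good w) :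
    W.Nonempty ∧ (1 / 4 : ℝ) ≤ ((W.filter good).card : ℝ) / (W.card : ℝ) := by
  classical
  have hWne : W.Nonempty := by
    by_contra hW
    rw [Finset.not_nonempty_iff_eq_empty] at hW
    apply h1
    rw [hW]
    norm_num
  refine ⟨hWne, ?_⟩
  have hWpos : (0 : ℝ) < W.card := by exact_mod_cast hWne.card_pos
  have hsub : W.filter tight ⊆ W.filter good ∪ W.filter small := by
    intro w hw
    rw [Finset.mem_filter] at hw
    rw [Finset.mem_union, Finset.mem_filter, Finset.mem_filter]
    by_cases hs : small w
    · exact Or.inr ⟨hw.1, hs⟩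
    · exact Or.inl ⟨hw.1, h3 w hw.1 hw.2 hs⟩
  have hcard : ((W.filter tight).card : ℝ) ≤ (W.filter good).card + (W.filter small).card := by
    exact_mod_cast (Finset.card_le_card hsub).trans (Finset.card_union_le _ _)
  rw [not_lt, le_div_iff₀ hWpos] at h1
  rw [div_lt_iff₀ hWpos] at h2
  rw [le_div_iff₀ hWpos]
  linarith

/-! ### The glue -/

/-- **stmt-PneNP-10859** `PlantedGlueR`: `FirstOrderGap → PlantedGenusPseudorandomR → BavardGapUncertifiable` (at `C = 0`:
the refuter at threshold `θ + θ/q₀` is a PPT distinguisher of advantage `≥ 1/4` eventually). [cite: Feige2002, §1.1] -/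
theorem bavardGap_plantedGlueR_proof : Summit.PneNP.PneNP.Theses.BavardGap.PlantedGlueR := by
  intro hGap hPL
  unfold Summit.PneNP.PneNP.Theses.BavardGap.BavardGapUncertifiable
  refine ⟨0, fun R hR hsound => ?_⟩
  by_contra hfreq
  rw [Filter.not_frequently] at hfreq
  obtain ⟨q, hq, hgap⟩ := hGap
  obtain ⟨PL, -, hsupp, hquiet⟩ := hPL q hq
  -- the deterministic distinguisher
  set G : List Bool → Bool := fun z : List Bool =>
      R ((List.range ((sndF z).length / 2)).map fun i =>
          ((if (sndF z).getD (2 * i) false then (1 : Fin 2) else 0), (sndF z).getD (2 * i + 1) false),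
        2 * (fstF z).length / (6 * Nat.log 3 (2 * (fstF z).length)) +
          2 * (fstF z).length / (6 * Nat.log 3 (2 * (fstF z).length)) / q) with hG
  have hGapply : ∀ (n : ℕ) (l : List (Fin 2 × Bool)),
      G (boolPair (unaryEncodeNat n) (l.flatMap fun a => [decide (a.1 = 1), a.2])) =
        R (l, 2 * n / (6 * Nat.log 3 (2 * n)) + 2 * n / (6 * Nat.log 3 (2 * n)) / q) := fun n l => by
    rw [hG]
    exact bavardGap_distinguisher_apply q R n l
  have hD := hquiet (RandAlg.ofDet G) (RandAlg.IsPolyTime.ofDet_holds (bavardGap_polyTime_distinguisher q hR))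
  have hsmall := hgap.eventually (gt_mem_nhds (show (0 : ℝ) < 1 / 8 by norm_num))
  obtain ⟨n, h1, hT, hS, hP⟩ := (hD.and_eventually (hfreq.and (hsmall.and hsupp))).exists
  -- planted side: acceptance probability 0 (soundness on the support)
  have hPL0 := bavardGap_bind_ofDet_apply_true_eq_zero (PL n) G n (fun s hs => by
    obtain ⟨w, -, rfl, π, hπ⟩ := hP s hs
    rw [hGapply]
    cases hRw : R (List.ofFn w, 2 * n / (6 * Nat.log 3 (2 * n)) + 2 * n / (6 * Nat.log 3 (2 * n)) / q) with
    | false => rfl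
    | true => exact absurd ⟨π, hπ⟩ (hsound _ _ hRw))
  -- null side: at least the `0`-tight words of genus `> θ + θ/q` are accepted
  obtain ⟨hWne, hge⟩ := bavardGap_count_bound _ _ _
    (fun w : Fin (2 * n) → Fin 2 × Bool => G (boolPair (unaryEncodeNat n)
      ((List.ofFn w).flatMap fun a => [decide (a.1 = 1), a.2])) = true) hT hS (fun w _ htight hns => by
    rw [hGapply]
    refine htight _ ?_
    simpa only [add_zero] using hns)
  rw [hPL0, bavardGap_null_accept _ hWne, zero_sub, abs_neg, abs_of_nonneg (by positivity)] at h1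
  linarith

end Summit.PneNP.PneNP.Theorems
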